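import Mathlib
import Summits.ResolutionOfSingularities.ResolutionOfSingularities.Theorems.WildQuotientsWildQuotientResolutionJordanThreeChartsA
import Summits.ResolutionOfSingularities.ResolutionOfSingularities.Theorems.WildQuotientsWildQuotientResolutionJordanThreeOneBlowup

/-!
# V3U-C4: the blow-up of the `A₁`-cone `× 𝔸ᵐ` at its vertex locus is regular

(crux stmt-ResolutionOfSingularities-15640 `WildQuotients.WildQuotientResolution`, line `Sketch`,
sector `|G| = p`; programme V3U («toric exit» for `J₃` at every `p ≥ 3`) of `L/w45c/CHAIN.md` v5,
candidate C4 `cone_affineBlowup_isRegular` of `L/w45c/W45cPlanSignaturesV5.lean` §C VERBATIM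
(quotient presentation). [OURS · L1 W4.5c] — NOT a statement of any manuscript; replaces the role of
no printed item. Prover res-L1-w45c-stub-4.)

The cone: `C = k[X_o : o ∈ Option (Fin n)] / (P R − Q²)` with `P = X (some a)`, `Q = X (some b)`,
`R = X none` (`a ≠ b`; the other `X (some i)` are passengers); centre `(P, Q, R)`. Charts of
`Bl_{(P,Q,R)} Spec C`: `D₊(P t) ≅ Spec k[P, q, passengers]` (`Q = P q`, `R = P q²`), `D₊(R t)`
symmetrically `k[R, q', passengers]`, and `D₊(Q t) ⊆ D₊(P t)` because `(Q t)² = (P t)(R t)` in the Rees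
algebra. Hence the blow-up is regular, by the generic criteria `JordanThree.isRegularRing_chartRing_of_chart`
(p483093) and `JordanThree.isRegular_affineBlowup_of_charts` (p483495).
-/

-- single-problem summit: the doubled namespace component `ResolutionOfSingularities` is forced
set_option linter.dupNamespace false

noncomputable section

open MvPolynomial IsLocalization AlgebraicGeometry CategoryTheory
open Literature.AlgebraicGeometry.Resolution

namespace Summit.ResolutionOfSingularities.ResolutionOfSingularities.Theorems.WildQuotientResolution.JordanThree

section Cone

variable (k : Type) [Field k] (n : ℕ) (a b : Fin n)

/-- The cone relation `P R = Q²` in `C = k[x]/(P R − Q²)`. [folklore] -/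
theorem cone_rel :
    Ideal.Quotient.mk (Ideal.span ({X (some a) * X none - X (some b) ^ 2} :
        Set (MvPolynomial (Option (Fin n)) k))) (X (some a)) *
      Ideal.Quotient.mk (Ideal.span ({X (some a) * X none - X (some b) ^ 2} :
        Set (MvPolynomial (Option (Fin n)) k))) (X none) =
      Ideal.Quotient.mk (Ideal.span ({X (some a) * X none - X (some b) ^ 2} :
        Set (MvPolynomial (Option (Fin n)) k))) (X (some b)) ^ 2 := by
  rw [← map_mul, ← map_pow, ← sub_eq_zero, ← map_sub, Ideal.Quotient.eq_zero_iff_mem]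
  exact Ideal.subset_span rfl

/-- **Chart `D₊(P t)` of the blow-up of the cone at its vertex locus is regular**: its chart ring is
the polynomial ring `k[P, q = Q/P, passengers]` (`Q = P q`, `R = P q²`). [folklore] -/
theorem isRegularRing_chartRing_cone_P (hab : a ≠ b) :
    IsRegularRing (chartRing
      (![Ideal.Quotient.mk (Ideal.span ({X (some a) * X none - X (some b) ^ 2} :
            Set (MvPolynomial (Option (Fin n)) k))) (X (some a)),
          Ideal.Quotient.mk (Ideal.span ({X (some a) * X none - X (some b) ^ 2} :
            Set (MvPolynomial (Option (Fin n)) k))) (X (some b)),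
          Ideal.Quotient.mk (Ideal.span ({X (some a) * X none - X (some b) ^ 2} :
            Set (MvPolynomial (Option (Fin n)) k))) (X none)] :
        Fin 3 → MvPolynomial (Option (Fin n)) k ⧸ Ideal.span
          ({X (some a) * X none - X (some b) ^ 2} : Set (MvPolynomial (Option (Fin n)) k))) 0) := by
  classical
  -- notation
  let J : Ideal (MvPolynomial (Option (Fin n)) k) :=
    Ideal.span ({X (some a) * X none - X (some b) ^ 2} : Set (MvPolynomial (Option (Fin n)) k))
  let π : MvPolynomial (Option (Fin n)) k →ₐ[k] MvPolynomial (Option (Fin n)) k ⧸ J :=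
    Ideal.Quotient.mkₐ k J
  let c : Fin 3 → MvPolynomial (Option (Fin n)) k ⧸ J := ![π (X (some a)), π (X (some b)), π (X none)]
  let L := Localization.Away (c 0)
  let am : (MvPolynomial (Option (Fin n)) k ⧸ J) →+* L := algebraMap _ L
  let ι : L := Away.invSelf (c 0)
  have hc0 : c 0 = π (X (some a)) := rfl
  have hc1 : c 1 = π (X (some b)) := rfl
  have hc2 : c 2 = π (X none) := rfl
  have hinv : am (c 0) * ι = 1 := Away.mul_invSelf (S := L) (c 0)
  have hrel : am (c 0) * am (c 2) = am (c 1) ^ 2 := by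
    rw [← map_mul, ← map_pow]
    exact congrArg am (cone_rel k n a b)
  haveI : IsRegularRing (MvPolynomial (Fin n) k) := MvPolynomial.isRegularRing_of_isRegularRing k
  have hba : b ≠ a := fun h => hab h.symm
  -- the chart map `x_a ↦ P`, `x_b ↦ q = Q/P`, `x_i ↦ passenger`
  let v : Fin n → L := fun i =>
    if i = a then am (c 0) else if i = b then am (c 1) * ι else am (π (X (some i)))
  let φ : MvPolynomial (Fin n) k →ₐ[k] L := aeval v
  have hφa : φ (X a) = am (c 0) := by simp [φ, v]
  have hφb : φ (X b) = am (c 1) * ι := by simp [φ, v, hba]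
  have hφi : ∀ i, i ≠ a → i ≠ b → φ (X i) = am (π (X (some i))) := fun i hia hib => by
    simp [φ, v, hia, hib]
  have hπC : ∀ r : k, π (C r) = algebraMap k _ r := fun r => π.commutes r
  have hφC : ∀ r : k, φ (C r) = am (π (C r)) := by
    intro r
    have h1 : φ (C r) = algebraMap k L r := aeval_C v r
    rw [h1, hπC, IsScalarTower.algebraMap_apply k (MvPolynomial (Option (Fin n)) k ⧸ J) L]
  -- the substitution `P ↦ x_a`, `Q ↦ x_a x_b`, `R ↦ x_a x_b²` kills the cone relation
  let w : Option (Fin n) → MvPolynomial (Fin n) k := fun o =>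
    o.elim (X a * X b ^ 2) (fun i => if i = b then X a * X b else X i)
  let θ₀ : MvPolynomial (Option (Fin n)) k →ₐ[k] MvPolynomial (Fin n) k := aeval w
  have hθa : θ₀ (X (some a)) = X a := by simp [θ₀, w, hab]
  have hθb : θ₀ (X (some b)) = X a * X b := by simp [θ₀, w]
  have hθn : θ₀ (X none) = X a * X b ^ 2 := by simp [θ₀, w]
  have hθi : ∀ i, i ≠ b → θ₀ (X (some i)) = X i := fun i hib => by simp [θ₀, w, hib]
  have hθ₀C : ∀ r : k, θ₀ (C r) = C r := fun r => aeval_C w r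
  have hθJ : ∀ x ∈ J, θ₀ x = 0 := by
    intro x hx
    obtain ⟨y, rfl⟩ := Ideal.mem_span_singleton'.1 hx
    rw [map_mul, map_sub, map_mul, map_pow, hθa, hθb, hθn]
    ring
  let θ : (MvPolynomial (Option (Fin n)) k ⧸ J) →ₐ[k] MvPolynomial (Fin n) k :=
    Ideal.Quotient.liftₐ J θ₀ hθJ
  have hθπ : ∀ x, θ (π x) = θ₀ x := fun x => rfl
  have hθC : ∀ r : k, θ (π (C r)) = C r := fun r => by
    rw [hθπ, hθ₀C]
  -- injectivity: extend `θ` to `C[1/P] → k[x][1/x_a]` and retract the chart map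
  let A' := Localization.Away (X a : MvPolynomial (Fin n) k)
  let alg : MvPolynomial (Fin n) k →+* A' := algebraMap _ A'
  have hunit : IsUnit ((alg.comp (θ : (MvPolynomial (Option (Fin n)) k ⧸ J) →+*
      MvPolynomial (Fin n) k)) (c 0)) := by
    change IsUnit (alg (θ (π (X (some a)))))
    rw [hθπ, hθa]
    exact IsLocalization.Away.algebraMap_isUnit (S := A') (X a)
  let Θ : L →+* A' := IsLocalization.Away.lift (c 0) hunit
  have hΘam : ∀ r, Θ (am r) = alg (θ r) := fun r => IsLocalization.Away.lift_eq (c 0) hunit r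
  have hΘι : alg (X a) * Θ ι = 1 := by
    have h : Θ (am (c 0) * ι) = 1 := by rw [Away.mul_invSelf, map_one]
    rw [map_mul, hΘam] at h
    change alg (θ (π (X (some a)))) * Θ ι = 1 at h
    rwa [hθπ, hθa] at h
  have hΘφ' : Θ.comp (φ : MvPolynomial (Fin n) k →+* L) = alg := by
    refine MvPolynomial.ringHom_ext (fun r => ?_) (fun i => ?_)
    · simp only [RingHom.coe_comp, RingHom.coe_coe, Function.comp_apply, hφC, hΘam, hθC]
    · simp only [RingHom.coe_comp, RingHom.coe_coe, Function.comp_apply]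
      by_cases hia : i = a
      · rw [hia, hφa, hΘam]
        change alg (θ (π (X (some a)))) = _
        rw [hθπ, hθa]
      · by_cases hib : i = b
        · rw [hib, hφb, map_mul, hΘam]
          change alg (θ (π (X (some b)))) * Θ ι = _
          rw [hθπ, hθb, map_mul]
          linear_combination (alg (X b)) * hΘι
        · rw [hφi i hia hib, hΘam, hθπ, hθi i hib]
  have hΘφ : ∀ r, Θ (φ r) = alg r := fun r => RingHom.congr_fun hΘφ' r
  have hinj : Function.Injective (φ : MvPolynomial (Fin n) k →+* L) := by
    intro p q hpq
    apply algebraMap_away_injective k n (X a) (X_ne_zero a)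
    change alg p = alg q
    rw [← hΘφ p, ← hΘφ q]
    exact congrArg Θ hpq
  -- values in the blowup algebra
  have hmem : ∀ p, (φ : MvPolynomial (Fin n) k →+* L) p ∈
      blowupAlgebra (Ideal.span (Set.range c)) (c 0) := by
    intro p
    induction p using MvPolynomial.induction_on with
    | C r =>
      rw [RingHom.coe_coe, hφC]
      exact Subalgebra.algebraMap_mem _ _
    | add p q hp hq =>
      rw [map_add]
      exact Subalgebra.add_mem _ hp hq
    | mul_X p i hp =>
      rw [map_mul]
      refine Subalgebra.mul_mem _ hp ?_
      by_cases hia : i = a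
      · rw [hia, RingHom.coe_coe, hφa]
        exact Subalgebra.algebraMap_mem _ _
      · by_cases hib : i = b
        · rw [hib, RingHom.coe_coe, hφb]
          exact div_mem_blowupAlgebra _ _ (Ideal.subset_span ⟨1, rfl⟩)
        · rw [RingHom.coe_coe, hφi i hia hib]
          exact Subalgebra.algebraMap_mem _ _
  -- chart ∘ substitution = localisation map ∘ quotient map
  have hφθ' : (φ : MvPolynomial (Fin n) k →+* L).comp
      (θ₀ : MvPolynomial (Option (Fin n)) k →+* MvPolynomial (Fin n) k) =
      am.comp (π : MvPolynomial (Option (Fin n)) k →+* MvPolynomial (Option (Fin n)) k ⧸ J) := by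
    refine MvPolynomial.ringHom_ext (fun r => ?_) (fun o => ?_)
    · simp only [RingHom.coe_comp, RingHom.coe_coe, Function.comp_apply]
      rw [hθ₀C, hφC]
    · simp only [RingHom.coe_comp, RingHom.coe_coe, Function.comp_apply]
      rcases o with _ | i
      · rw [hθn, map_mul, map_pow, hφa, hφb, ← hc2]
        linear_combination (-(am (c 0) * ι ^ 2)) * hrel + (am (c 2) * (am (c 0) * ι + 1)) * hinv
      · by_cases hib : i = b
        · rw [hib, hθb, map_mul, hφa, hφb, ← hc1]
          linear_combination (am (c 1)) * hinv
        · rw [hθi i hib]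
          by_cases hia : i = a
          · rw [hia, hφa]
            exact congrArg am hc0
          · rw [hφi i hia hib]
  have hbase : ∀ r : MvPolynomial (Option (Fin n)) k ⧸ J, am r ∈
      Set.range (φ : MvPolynomial (Fin n) k →+* L) := by
    intro r
    obtain ⟨x, rfl⟩ := Ideal.Quotient.mk_surjective r
    exact ⟨θ₀ x, RingHom.congr_fun hφθ' x⟩
  -- the generators `P/P, Q/P, R/P` are values of the chart map
  have hgen : ∀ j : Fin 3, am (c j) * ι ∈ Set.range (φ : MvPolynomial (Fin n) k →+* L) := by
    intro j
    fin_cases j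
    · exact ⟨1, by rw [map_one]; exact hinv.symm⟩
    · exact ⟨X b, by rw [RingHom.coe_coe, hφb]; rfl⟩
    · refine ⟨X b ^ 2, ?_⟩
      rw [RingHom.coe_coe, map_pow, hφb]
      change _ = am (c 2) * ι
      linear_combination (-(ι ^ 2)) * hrel + (am (c 2) * ι) * hinv
  have hrange := range_eq_blowupAlgebra_of_chart c 0 (φ : MvPolynomial (Fin n) k →+* L) hmem
    hbase hgen
  exact isRegularRing_chartRing_of_chart c 0 (φ : MvPolynomial (Fin n) k →+* L) hinj hrange

/-- **Chart `D₊(R t)` of the blow-up of the cone at its vertex locus is regular**: its chart ring is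
the polynomial ring `k[R, q' = Q/R, passengers]` (`Q = R q'`, `P = R q'²`). [folklore] -/
theorem isRegularRing_chartRing_cone_R (hab : a ≠ b) :
    IsRegularRing (chartRing
      (![Ideal.Quotient.mk (Ideal.span ({X (some a) * X none - X (some b) ^ 2} :
            Set (MvPolynomial (Option (Fin n)) k))) (X (some a)),
          Ideal.Quotient.mk (Ideal.span ({X (some a) * X none - X (some b) ^ 2} :
            Set (MvPolynomial (Option (Fin n)) k))) (X (some b)),
          Ideal.Quotient.mk (Ideal.span ({X (some a) * X none - X (some b) ^ 2} :
            Set (MvPolynomial (Option (Fin n)) k))) (X none)] :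
        Fin 3 → MvPolynomial (Option (Fin n)) k ⧸ Ideal.span
          ({X (some a) * X none - X (some b) ^ 2} : Set (MvPolynomial (Option (Fin n)) k))) 2) := by
  classical
  -- notation
  let J : Ideal (MvPolynomial (Option (Fin n)) k) :=
    Ideal.span ({X (some a) * X none - X (some b) ^ 2} : Set (MvPolynomial (Option (Fin n)) k))
  let π : MvPolynomial (Option (Fin n)) k →ₐ[k] MvPolynomial (Option (Fin n)) k ⧸ J :=
    Ideal.Quotient.mkₐ k J
  let c : Fin 3 → MvPolynomial (Option (Fin n)) k ⧸ J := ![π (X (some a)), π (X (some b)), π (X none)]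
  let L := Localization.Away (c 2)
  let am : (MvPolynomial (Option (Fin n)) k ⧸ J) →+* L := algebraMap _ L
  let ι : L := Away.invSelf (c 2)
  have hc0 : c 0 = π (X (some a)) := rfl
  have hc1 : c 1 = π (X (some b)) := rfl
  have hc2 : c 2 = π (X none) := rfl
  have hinv : am (c 2) * ι = 1 := Away.mul_invSelf (S := L) (c 2)
  have hrel : am (c 0) * am (c 2) = am (c 1) ^ 2 := by
    rw [← map_mul, ← map_pow]
    exact congrArg am (cone_rel k n a b)
  haveI : IsRegularRing (MvPolynomial (Fin n) k) := MvPolynomial.isRegularRing_of_isRegularRing k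
  have hba : b ≠ a := fun h => hab h.symm
  -- the chart map `x_a ↦ R`, `x_b ↦ q' = Q/R`, `x_i ↦ passenger`
  let v : Fin n → L := fun i =>
    if i = a then am (c 2) else if i = b then am (c 1) * ι else am (π (X (some i)))
  let φ : MvPolynomial (Fin n) k →ₐ[k] L := aeval v
  have hφa : φ (X a) = am (c 2) := by simp [φ, v]
  have hφb : φ (X b) = am (c 1) * ι := by simp [φ, v, hba]
  have hφi : ∀ i, i ≠ a → i ≠ b → φ (X i) = am (π (X (some i))) := fun i hia hib => by
    simp [φ, v, hia, hib]
  have hπC : ∀ r : k, π (C r) = algebraMap k _ r := fun r => π.commutes r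
  have hφC : ∀ r : k, φ (C r) = am (π (C r)) := by
    intro r
    have h1 : φ (C r) = algebraMap k L r := aeval_C v r
    rw [h1, hπC, IsScalarTower.algebraMap_apply k (MvPolynomial (Option (Fin n)) k ⧸ J) L]
  -- the substitution `R ↦ x_a`, `Q ↦ x_a x_b`, `P ↦ x_a x_b²` kills the cone relation
  let w : Option (Fin n) → MvPolynomial (Fin n) k := fun o =>
    o.elim (X a) (fun i => if i = a then X a * X b ^ 2 else if i = b then X a * X b else X i)
  let θ₀ : MvPolynomial (Option (Fin n)) k →ₐ[k] MvPolynomial (Fin n) k := aeval w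
  have hθa : θ₀ (X (some a)) = X a * X b ^ 2 := by simp [θ₀, w]
  have hθb : θ₀ (X (some b)) = X a * X b := by simp [θ₀, w, hba]
  have hθn : θ₀ (X none) = X a := by simp [θ₀, w]
  have hθi : ∀ i, i ≠ a → i ≠ b → θ₀ (X (some i)) = X i := fun i hia hib => by
    simp [θ₀, w, hia, hib]
  have hθ₀C : ∀ r : k, θ₀ (C r) = C r := fun r => aeval_C w r
  have hθJ : ∀ x ∈ J, θ₀ x = 0 := by
    intro x hx
    obtain ⟨y, rfl⟩ := Ideal.mem_span_singleton'.1 hx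
    rw [map_mul, map_sub, map_mul, map_pow, hθa, hθb, hθn]
    ring
  let θ : (MvPolynomial (Option (Fin n)) k ⧸ J) →ₐ[k] MvPolynomial (Fin n) k :=
    Ideal.Quotient.liftₐ J θ₀ hθJ
  have hθπ : ∀ x, θ (π x) = θ₀ x := fun x => rfl
  have hθC : ∀ r : k, θ (π (C r)) = C r := fun r => by
    rw [hθπ, hθ₀C]
  -- injectivity: extend `θ` to `C[1/P] → k[x][1/x_a]` and retract the chart map
  let A' := Localization.Away (X a : MvPolynomial (Fin n) k)
  let alg : MvPolynomial (Fin n) k →+* A' := algebraMap _ A'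
  have hunit : IsUnit ((alg.comp (θ : (MvPolynomial (Option (Fin n)) k ⧸ J) →+*
      MvPolynomial (Fin n) k)) (c 2)) := by
    change IsUnit (alg (θ (π (X none))))
    rw [hθπ, hθn]
    exact IsLocalization.Away.algebraMap_isUnit (S := A') (X a)
  let Θ : L →+* A' := IsLocalization.Away.lift (c 2) hunit
  have hΘam : ∀ r, Θ (am r) = alg (θ r) := fun r => IsLocalization.Away.lift_eq (c 2) hunit r
  have hΘι : alg (X a) * Θ ι = 1 := by
    have h : Θ (am (c 2) * ι) = 1 := by rw [Away.mul_invSelf, map_one]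
    rw [map_mul, hΘam] at h
    change alg (θ (π (X none))) * Θ ι = 1 at h
    rwa [hθπ, hθn] at h
  have hΘφ' : Θ.comp (φ : MvPolynomial (Fin n) k →+* L) = alg := by
    refine MvPolynomial.ringHom_ext (fun r => ?_) (fun i => ?_)
    · simp only [RingHom.coe_comp, RingHom.coe_coe, Function.comp_apply, hφC, hΘam, hθC]
    · simp only [RingHom.coe_comp, RingHom.coe_coe, Function.comp_apply]
      by_cases hia : i = a
      · rw [hia, hφa, hΘam]
        change alg (θ (π (X none))) = _
        rw [hθπ, hθn]
      · by_cases hib : i = b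
        · rw [hib, hφb, map_mul, hΘam]
          change alg (θ (π (X (some b)))) * Θ ι = _
          rw [hθπ, hθb, map_mul]
          linear_combination (alg (X b)) * hΘι
        · rw [hφi i hia hib, hΘam, hθπ, hθi i hia hib]
  have hΘφ : ∀ r, Θ (φ r) = alg r := fun r => RingHom.congr_fun hΘφ' r
  have hinj : Function.Injective (φ : MvPolynomial (Fin n) k →+* L) := by
    intro p q hpq
    apply algebraMap_away_injective k n (X a) (X_ne_zero a)
    change alg p = alg q
    rw [← hΘφ p, ← hΘφ q]
    exact congrArg Θ hpq
  -- values in the blowup algebra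
  have hmem : ∀ p, (φ : MvPolynomial (Fin n) k →+* L) p ∈
      blowupAlgebra (Ideal.span (Set.range c)) (c 2) := by
    intro p
    induction p using MvPolynomial.induction_on with
    | C r =>
      rw [RingHom.coe_coe, hφC]
      exact Subalgebra.algebraMap_mem _ _
    | add p q hp hq =>
      rw [map_add]
      exact Subalgebra.add_mem _ hp hq
    | mul_X p i hp =>
      rw [map_mul]
      refine Subalgebra.mul_mem _ hp ?_
      by_cases hia : i = a
      · rw [hia, RingHom.coe_coe, hφa]
        exact Subalgebra.algebraMap_mem _ _
      · by_cases hib : i = b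
        · rw [hib, RingHom.coe_coe, hφb]
          exact div_mem_blowupAlgebra _ _ (Ideal.subset_span ⟨1, rfl⟩)
        · rw [RingHom.coe_coe, hφi i hia hib]
          exact Subalgebra.algebraMap_mem _ _
  -- chart ∘ substitution = localisation map ∘ quotient map
  have hφθ' : (φ : MvPolynomial (Fin n) k →+* L).comp
      (θ₀ : MvPolynomial (Option (Fin n)) k →+* MvPolynomial (Fin n) k) =
      am.comp (π : MvPolynomial (Option (Fin n)) k →+* MvPolynomial (Option (Fin n)) k ⧸ J) := by
    refine MvPolynomial.ringHom_ext (fun r => ?_) (fun o => ?_)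
    · simp only [RingHom.coe_comp, RingHom.coe_coe, Function.comp_apply]
      rw [hθ₀C, hφC]
    · simp only [RingHom.coe_comp, RingHom.coe_coe, Function.comp_apply]
      rcases o with _ | i
      · rw [hθn, hφa]
        exact congrArg am hc2
      · by_cases hia : i = a
        · rw [hia, hθa, map_mul, map_pow, hφa, hφb, ← hc0]
          linear_combination (-(am (c 2) * ι ^ 2)) * hrel + (am (c 0) * (am (c 2) * ι + 1)) * hinv
        · by_cases hib : i = b
          · rw [hib, hθb, map_mul, hφa, hφb, ← hc1]
            linear_combination (am (c 1)) * hinv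
          · rw [hθi i hia hib, hφi i hia hib]
  have hbase : ∀ r : MvPolynomial (Option (Fin n)) k ⧸ J, am r ∈
      Set.range (φ : MvPolynomial (Fin n) k →+* L) := by
    intro r
    obtain ⟨x, rfl⟩ := Ideal.Quotient.mk_surjective r
    exact ⟨θ₀ x, RingHom.congr_fun hφθ' x⟩
  -- the generators `P/R, Q/R, R/R` are values of the chart map
  have hgen : ∀ j : Fin 3, am (c j) * ι ∈ Set.range (φ : MvPolynomial (Fin n) k →+* L) := by
    intro j
    fin_cases j
    · refine ⟨X b ^ 2, ?_⟩
      rw [RingHom.coe_coe, map_pow, hφb]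
      change _ = am (c 0) * ι
      linear_combination (-(ι ^ 2)) * hrel + (am (c 0) * ι) * hinv
    · exact ⟨X b, by rw [RingHom.coe_coe, hφb]; rfl⟩
    · exact ⟨1, by rw [map_one]; exact hinv.symm⟩
  have hrange := range_eq_blowupAlgebra_of_chart c 2 (φ : MvPolynomial (Fin n) k →+* L) hmem
    hbase hgen
  exact isRegularRing_chartRing_of_chart c 2 (φ : MvPolynomial (Fin n) k →+* L) hinj hrange

end Cone

end Summit.ResolutionOfSingularities.ResolutionOfSingularities.Theorems.WildQuotientResolution.JordanThree

end
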